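import Literature.AlgebraicGeometry.Resolution.ArithmeticalThreefoldsLocal
import Literature.AlgebraicGeometry.Resolution.ModelTransport
import HarnessLib

/-!
# Consuming the local theorem over the local ring of a model (Cossart–Piltant, proof of Prop. 4.10)

Topic: `Literature/AlgebraicGeometry/Resolution`. First piece of the PROOF side of
`CossartPiltant2019ReductionP` (`ArithmeticalThreefoldsLocal.lean`): how the (weak) local
theorem `CossartPiltant2019Local` (Cossart–Piltant 2019, journal Thm. 1.5 = arXiv v1 Thm. 1.4)
is applied inside the proof of journal Prop. 4.10 (arXiv v1 Prop. 4.8, p. 54). There the base of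
Thm. 1.5 is not the complete regular local ring `S` one starts from but the regular local ring
`T_P` of a local uniformization `T` obtained at the previous stage of the ramification-theoretic
tower ("By proposition 4.4, it can be assumed that `fᵢ ∈ Tʳ`, `1 ≤ i ≤ p`, where `(LU v₀ʳ)`
holds on `𝒯ʳ := Spec Tʳ`. Theorem 1.5 (ii) states that `(LU vʳ)` holds"), and its conclusion —
a model `T_P[x][t']` regular at the centre of the valuation — has to be turned back into a
finitely generated model over `S`, so that the procedure can be iterated and, at the end,
compared with (LU) for the complete local domain.

* `CossartPiltant2019Local.exists_adjoin_union_isRegularLocalRing` — for an `S`-subalgebra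
  `T ⊆ 𝒪_v` of a field `L` with centre `P = {v < 1}` whose local ring `T_P` (any localization
  `Sₚ`, realised in `L`) is excellent, regular, of dimension three and residue characteristic
  `p`, and a degree-`p` step `L = K(x)`, `K = Frac T_P`, in case (i) or (ii) of the local
  theorem: `S[T ∪ {x} ∪ t'] ⊆ 𝒪_v` is regular at its centre for some finite `t' ⊆ L`
  (the local theorem over `T_P`, then `S[T ∪ {x} ∪ t'] ⊆ T_P[x][t'] ⊆ S[T ∪ {x} ∪ t']_𝔪`,
  `ModelTransport.lean`);
* `CossartPiltant2019Local.exists_adjoin_map_union_isRegularLocalRing` — the same with the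
  previous model `T ⊆ K` and the step field given as an algebra `K → L` (the shape produced by
  an induction along a tower of field extensions), `T_P` serving as the localization of
  `T.map (K → L)` by transport along `T ≃ T.map`.

The hypotheses on `T_P` are discharged elsewhere: dimension three by the dimension formula
(`LocalModels.lean`, `DimensionFormula.lean`, for `S` universally catenary and `v` residually
algebraic, `ResidueAlgebraicTower.lean`), regularity by the previous stage, residue
characteristic by domination; excellence by the stability of excellence under essentially
finite type extensions (`isExcellentRing_localization_atPrime`, `ExcellentRingsEssFiniteType.lean`,
resting on `Stacks07PV_holds`).

Everything is PROVED; no named facts are introduced (the local theorem enters as the hypothesis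
`hloc : CossartPiltant2019Local`, as in `CossartPiltant2019ReductionP` itself).

## Sources

* V. Cossart, O. Piltant, J. Algebra 529 (2019) 268–535 = arXiv:1412.0868: journal Thm. 1.5 and
  proof of Prop. 4.10 (arXiv v1: Thm. 1.4 p. 4; Prop. 4.8, proof pp. 53–54). [CossartPiltant2019]
-/

noncomputable section

open IsLocalRing Polynomial

namespace Literature.AlgebraicGeometry.Resolution

universe u

/-- **The local theorem over the local ring of a model.** Let `S → L` be a commutative ring
mapping to a field, `O` a valuation ring of `L`, `T ⊆ O` an `S`-subalgebra of `L` with centre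
`P = {v < 1}`, and `Sₚ = T_P` its local ring (any localization of `T` at `P`, realised in `L`),
assumed to be an excellent regular local ring of dimension three and residue characteristic
`p`. Let `K = Frac Sₚ ⊆ L` with `L = K(x)`, `x` a root of a monic `h ∈ Sₚ[X]` of degree `p`
irreducible over `K`, in case (i) or (ii) of Cossart–Piltant's local theorem
(`CossartPiltant2019Local`). Then the local theorem — "there exists a composition of local
Hironaka-permissible blowing ups … such that `(𝒳_r, x_r)` is regular", in its weak form: a finite
`t' ⊆ L` with `Sₚ[x][t'] ⊆ O` regular at the centre — yields a finitely generated model OVER `S`: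
`S[T ∪ {x} ∪ t'] ⊆ O` is regular at its centre, because
`S[T ∪ {x} ∪ t'] ⊆ T_P[x][t'] ⊆ S[T ∪ {x} ∪ t']_{𝔪_O ∩ S[T ∪ {x} ∪ t']}`
(`isRegularLocalRing_localization_adjoin_union_iff`). This is the form in which Cossart–Piltant
apply Thm. 1.5 in the proof of Prop. 4.10: "Let `x ∈ 𝒪_{vʳ}` be a primitive element with
minimal polynomial `h := X^p + f₁X^{p-1} + ⋯ + f_p ∈ 𝒪_{v₀ʳ}[X]`. By proposition 4.4, it can
be assumed that `fᵢ ∈ Tʳ`, `1 ≤ i ≤ p`, where `(LU v₀ʳ)` holds on 𝒯ʳ := Spec Tʳ`. Theorem 1.5 (ii)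
states that `(LU vʳ)` holds", the base of Thm. 1.5 being the regular local ring `Tʳ_{𝔪_{v₀ʳ} ∩ Tʳ}`
of the previous local uniformization.
[cite: CossartPiltant2019, proof of Prop. 4.10 (arXiv v1: Prop. 4.8, p. 54) with Thm. 1.5 (arXiv v1: Thm. 1.4)] -/
theorem CossartPiltant2019Local.exists_adjoin_union_isRegularLocalRing
    (hloc : CossartPiltant2019Local.{u}) (p : ℕ) (hp : p.Prime)
    {S L : Type u} [CommRing S] [Field L] [Algebra S L] (O : ValuationSubring L)
    (T : Subalgebra S L) (hTO : ∀ x : T, (x : L) ∈ O) (P : Ideal T) [P.IsPrime]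
    (hP : ∀ x : T, x ∈ P ↔ O.valuation (x : L) < 1)
    (Sₚ : Type u) [CommRing Sₚ] [IsDomain Sₚ] [IsRegularLocalRing Sₚ] [Algebra T Sₚ]
    [IsLocalization.AtPrime Sₚ P] [Algebra Sₚ L] [IsScalarTower T Sₚ L] [Algebra S Sₚ]
    [IsScalarTower S Sₚ L]
    (hexc : IsExcellentRing Sₚ) (hdim : ringKrullDim Sₚ = 3) (hchar : CharP (ResidueField Sₚ) p)
    (K : Type u) [Field K] [Algebra Sₚ K] [IsFractionRing Sₚ K] [Algebra K L]
    [IsScalarTower Sₚ K L]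
    (h : Sₚ[X]) (x : L) (hmon : h.Monic) (hdeg : h.natDegree = p)
    (hirr : Irreducible (h.map (algebraMap Sₚ K))) (hx : aeval x h = 0)
    (hgen : Algebra.adjoin K ({x} : Set L) = ⊤)
    (hcase : (CharP K p ∧ ∀ i, 0 < i → i < p → h.coeff i = 0) ∨
      (Nat.card (L ≃ₐ[K] L) = p ∧
        ∀ σ : L ≃ₐ[K] L, ∀ y ∈ Algebra.adjoin Sₚ ({x} : Set L),
          σ y ∈ Algebra.adjoin Sₚ ({x} : Set L))) :
    ∃ (u : Finset L)
      (hu : (Algebra.adjoin S ((T : Set L) ∪ insert x (u : Set L))).toSubring ≤ O.toSubring),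
      IsRegularLocalRing (Localization.AtPrime
        (Ideal.comap (Subring.inclusion hu) (maximalIdeal O))) := by
  classical
  -- elements of `T_P` inside `L`: `a/b` with `a ∈ T`, `b ∈ T ∖ P`, `v(b) = 1`
  have hval : ∀ (a : T) (b : P.primeCompl),
      algebraMap Sₚ L (IsLocalization.mk' Sₚ a b) = (a : L) * (((b : T) : L))⁻¹ ∧
        O.valuation ((b : T) : L) = 1 := by
    intro a b
    have hb : O.valuation ((b : T) : L) = 1 := by
      have hle : O.valuation ((b : T) : L) ≤ 1 := (O.valuation_le_one_iff _).mpr (hTO _)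
      have hnlt : ¬ O.valuation ((b : T) : L) < 1 := fun hlt => b.2 ((hP _).mpr hlt)
      exact le_antisymm hle (not_lt.mp hnlt)
    have hb0 : ((b : T) : L) ≠ 0 := fun h0 => by rw [h0, map_zero] at hb; exact zero_ne_one hb
    refine ⟨?_, hb⟩
    have h1 := IsLocalization.mk'_spec Sₚ a b
    have h2 := congrArg (algebraMap Sₚ L) h1
    rw [map_mul, ← IsScalarTower.algebraMap_apply, ← IsScalarTower.algebraMap_apply] at h2
    have h3 : algebraMap Sₚ L (IsLocalization.mk' Sₚ a b) * ((b : T) : L) = (a : L) := h2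
    rw [← h3, mul_inv_cancel_right₀ hb0]
  have hSO : ∀ s : Sₚ, algebraMap Sₚ L s ∈ O := by
    intro s
    obtain ⟨⟨a, b⟩, rfl⟩ := IsLocalization.mk'_surjective P.primeCompl s
    obtain ⟨hab, hb⟩ := hval a b
    rw [hab]
    refine mul_mem (hTO a) ?_
    rw [← O.valuation_le_one_iff, map_inv₀, hb, inv_one]
  have hcen : ∀ s ∈ maximalIdeal Sₚ, O.valuation (algebraMap Sₚ L s) < 1 := by
    intro s hs
    obtain ⟨⟨a, b⟩, rfl⟩ := IsLocalization.mk'_surjective P.primeCompl s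
    obtain ⟨hab, hb⟩ := hval a b
    have haP : a ∈ P := (IsLocalization.AtPrime.mk'_mem_maximal_iff Sₚ P a b).mp hs
    rw [hab, map_mul, map_inv₀, hb, inv_one, mul_one]
    exact (hP a).mp haP
  -- the local theorem over `T_P`
  obtain ⟨t', ht', hreg'⟩ :=
    hloc p hp Sₚ hexc hdim hchar K L h x hmon hdeg hirr hx hgen hcase O hSO hcen
  -- back to a model over `S`
  let B : Subalgebra Sₚ L := Algebra.adjoin Sₚ (insert x (t' : Set L))
  set Q : Ideal B := Ideal.comap (Subring.inclusion ht') (maximalIdeal O) with hQdef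
  haveI : Q.IsPrime := Ideal.IsPrime.comap _
  have hQ : ∀ y : B, y ∈ Q ↔ O.valuation (y : L) < 1 := fun y => by
    rw [hQdef, Ideal.mem_comap, ValuationSubring.valuation_lt_one_iff]; rfl
  let A : Subalgebra S L := Algebra.adjoin S ((T : Set L) ∪ insert x (t' : Set L))
  have hAB : ∀ y : A, (y : L) ∈ B := fun y =>
    mem_adjoin_localization_of_mem_adjoin_union T Sₚ (insert x (t' : Set L)) y.2
  have hu : A.toSubring ≤ O.toSubring := fun y hy => ht' (hAB ⟨y, hy⟩)
  refine ⟨t', hu, ?_⟩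
  set P' : Ideal A := Ideal.comap (Subring.inclusion hu) (maximalIdeal O) with hP'def
  haveI : P'.IsPrime := Ideal.IsPrime.comap _
  have hP' : ∀ y : A, y ∈ P' ↔ O.valuation (y : L) < 1 := fun y => by
    rw [hP'def, Ideal.mem_comap, ValuationSubring.valuation_lt_one_iff]; rfl
  exact (isRegularLocalRing_localization_adjoin_union_iff O T P Sₚ hP (insert x (t' : Set L)) P'
    hP' Q hQ).mpr hreg'

/-- **Relative form: the base model in `K`, the step in `L ⊇ K`.** As
`CossartPiltant2019Local.exists_adjoin_union_isRegularLocalRing`, but with the previous model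
`T ⊆ K = Frac T_P` and the degree-`p` step `L = K(x)` a field extension given as an algebra
`K → L` (the shape produced by an induction along a tower of field extensions): the model
`T ⊆ K` is pushed into `L` (`T.map (K → L)`), its localization `T_P` serves as the localization
of the image (transport of `IsLocalization` along `T ≃ T.map`), and the local theorem over `T_P`
yields `S[T ∪ {x} ∪ t'] ⊆ 𝒪_v ⊆ L` regular at the centre (the generating set written with
`T.map (K → L)`; `Subalgebra.coe_map` turns it into the image of `T`).
[cite: CossartPiltant2019, proof of Prop. 4.10 (arXiv v1: Prop. 4.8, p. 54) with Thm. 1.5 (arXiv v1: Thm. 1.4)] -/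
theorem CossartPiltant2019Local.exists_adjoin_map_union_isRegularLocalRing
    (hloc : CossartPiltant2019Local.{u}) (p : ℕ) (hp : p.Prime)
    {S K L : Type u} [CommRing S] [Field K] [Field L] [Algebra S K] [Algebra K L] [Algebra S L]
    [IsScalarTower S K L] (O : ValuationSubring L)
    (T : Subalgebra S K) (hTO : ∀ x : T, algebraMap K L x ∈ O) (P : Ideal T) [P.IsPrime]
    (hP : ∀ x : T, x ∈ P ↔ O.valuation (algebraMap K L x) < 1)
    (Sₚ : Type u) [CommRing Sₚ] [IsDomain Sₚ] [IsRegularLocalRing Sₚ] [Algebra T Sₚ]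
    [IsLocalization.AtPrime Sₚ P] [Algebra Sₚ K] [IsScalarTower T Sₚ K] [IsFractionRing Sₚ K]
    [Algebra S Sₚ] [IsScalarTower S Sₚ K] [Algebra Sₚ L] [IsScalarTower Sₚ K L]
    (hexc : IsExcellentRing Sₚ) (hdim : ringKrullDim Sₚ = 3) (hchar : CharP (ResidueField Sₚ) p)
    (h : Sₚ[X]) (x : L) (hmon : h.Monic) (hdeg : h.natDegree = p)
    (hirr : Irreducible (h.map (algebraMap Sₚ K))) (hx : aeval x h = 0)
    (hgen : Algebra.adjoin K ({x} : Set L) = ⊤)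
    (hcase : (CharP K p ∧ ∀ i, 0 < i → i < p → h.coeff i = 0) ∨
      (Nat.card (L ≃ₐ[K] L) = p ∧
        ∀ σ : L ≃ₐ[K] L, ∀ y ∈ Algebra.adjoin Sₚ ({x} : Set L),
          σ y ∈ Algebra.adjoin Sₚ ({x} : Set L))) :
    ∃ (u : Finset L)
      (hu : (Algebra.adjoin S (((T.map (IsScalarTower.toAlgHom S K L) : Subalgebra S L) : Set L) ∪
        insert x (u : Set L))).toSubring ≤ O.toSubring),
      IsRegularLocalRing (Localization.AtPrime
        (Ideal.comap (Subring.inclusion hu) (maximalIdeal O))) := by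
  classical
  let φ : K →ₐ[S] L := IsScalarTower.toAlgHom S K L
  have hφ : ∀ z, φ z = algebraMap K L z := fun _ => rfl
  have hφinj : Function.Injective φ := (algebraMap K L).injective
  let T' : Subalgebra S L := T.map φ
  let e : T ≃ₐ[S] T' := T.equivMapOfInjective φ hφinj
  have he : ∀ y : T, ((e y : T') : L) = algebraMap K L y := fun _ => rfl
  have he' : ∀ y : T', algebraMap K L (e.symm y : T) = (y : L) := fun y => by
    rw [← he, AlgEquiv.apply_symm_apply]
  -- `T_P` as a localization of the image `T'`
  letI : Algebra T' Sₚ := ((algebraMap T Sₚ).comp e.symm.toRingEquiv.toRingHom).toAlgebra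
  set P' : Ideal T' := P.comap e.symm.toRingEquiv.toRingHom with hP'def
  haveI : P'.IsPrime := Ideal.IsPrime.comap _
  have hP' : ∀ y : T', y ∈ P' ↔ O.valuation (y : L) < 1 := fun y => by
    rw [hP'def, Ideal.mem_comap, hP]
    change O.valuation (algebraMap K L (e.symm y : T)) < 1 ↔ _
    rw [he']
  have hmap : Submonoid.map e.toRingEquiv P.primeCompl = P'.primeCompl := by
    ext y
    constructor
    · rintro ⟨z, hz, rfl⟩
      change (e z : T') ∉ P'
      rw [hP'def, Ideal.mem_comap]
      change (e.symm (e z) : T) ∉ P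
      rw [AlgEquiv.symm_apply_apply]
      exact hz
    · intro hy
      refine ⟨e.symm y, ?_, by simp⟩
      change (e.symm y : T) ∉ P
      intro hmem
      apply hy
      exact Ideal.mem_comap.mpr hmem
  haveI : IsLocalization.AtPrime Sₚ P' := by
    have hloc' := IsLocalization.isLocalization_of_base_ringEquiv P.primeCompl Sₚ e.toRingEquiv
    rw [hmap] at hloc'
    exact hloc'
  haveI : IsScalarTower T' Sₚ L := IsScalarTower.of_algebraMap_eq fun y => by
    change (y : L) = algebraMap Sₚ L (algebraMap T Sₚ (e.symm y : T))
    rw [IsScalarTower.algebraMap_apply Sₚ K L, ← IsScalarTower.algebraMap_apply T Sₚ K]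
    exact (he' y).symm
  haveI : IsScalarTower S Sₚ L := IsScalarTower.of_algebraMap_eq fun s => by
    rw [IsScalarTower.algebraMap_apply S K L, IsScalarTower.algebraMap_apply S Sₚ K,
      ← IsScalarTower.algebraMap_apply Sₚ K L]
  have hTO' : ∀ y : T', (y : L) ∈ O := fun y => by rw [← he']; exact hTO _
  exact hloc.exists_adjoin_union_isRegularLocalRing p hp O T' hTO' P' hP' Sₚ hexc hdim hchar K h x
    hmon hdeg hirr hx hgen hcase

end Literature.AlgebraicGeometry.Resolution
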